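import Summits.AtomisticToContinuum.HydrodynamicLimit.Theorems.AntiMazurCoboundariesCorrectorPressureDecayKiferCanonicalLocalLimit
import Summits.AtomisticToContinuum.HydrodynamicLimit.Theorems.AntiMazurCoboundariesCorrectorPressureDecayKiferCanonicalBlowUpDomination
import Summits.AtomisticToContinuum.HydrodynamicLimit.Theorems.AntiMazurCoboundariesCorrectorPressureDecayKiferGibbsReferenceSwap
import Literature.MathematicalPhysics.KineticTheory.HardSphereGibbsGNZSandwich
import Mathlib.InformationTheory.KullbackLeibler.Basic

/-!
# Uniform finiteness of the window entropy of the blown-up canonical laws against the free block reference (line `FirstLemma`, crux stmt-AtomisticToContinuum-14135)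

Registered stub `c9_klDiv_windowLaw_canonicalBlowUp_free_le` (lead seat c9, Gibbs route of the tangent entropy bound
`stub_tangentEntropyBoundUniformGibbs`), namespace
`Summit.AtomisticToContinuum.HydrodynamicLimit.Theorems.KiferCompactification`: for `0 < σ ≤ 1/2`, `a, θ, z > 0` and a
centred box `Λ = Λ_n`, the relative entropy of the window law `P = (canonicalBlowUpLaw σ a θ u₀ N Φ)_Λ` of the
x-averaged blown-up canonical law with respect to the FREE finite-volume hard-sphere law
`γ = gibbsSpecMeasure 1 z θ⁻¹ u₀ Λ ∅` (specification with empty boundary condition) is bounded UNIFORMLY in the size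
`N` (and the flow `Φ`).

Proof. `P ≤ c • γ` setwise with an explicit constant `c = c(σ, z, n)`, whence `KL(P ‖ γ) ≤ KL(P ‖ P) + log c = log c`
(`klDiv_le_klDiv_add_ofReal_log_of_le_smul`, `…KiferGibbsReferenceSwap.lean`). The setwise bound:

* `windowLaw_canonicalBlowUp_le_sum` — the window law is dominated by the explicit majorant
  `M = ∑ₘ (ξᵐ/m!) · cfg_* (Leb_Λ ⊗ N(u₀,θ))^{⊗m}`, `ξ = σ³/(1 - v₁σ³)` (this is the majorant exhibited in the proof of
  `stub_canonicalBlowUpWindowDomination`, `…KiferCanonicalBlowUpDomination.lean`, made explicit);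
* `maxwellPhaseMeasure_inv_eq_prod_gaussMeasure'`, `superposeIn_empty_eq_windowRestrict_ofFn` — the un-normalised free
  weight `W • γ = gibbsWeightMeasure … Λ ∅ = ∑ₘ (zᵐ/m!) · cfg_* ((Leb_Λ ⊗ N(u₀,θ))^{⊗m}|_{hard core})` is a mixture of the
  SAME labelled reference laws pushed forward by the SAME configuration map, with `zᵐ` for `ξᵐ` and the window hard-core
  indicator inserted; `1 ≤ W ≤ e^{z vol Λ}` (`gibbsWeight_univ_le_ofReal_exp`);
* `P` is carried by unit-hard-core configurations (`ae_isHardCore_canonicalBlowUp`), and by PACKING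
  (`card_le_of_separated`) a hard-core window configuration of `m` a.s.-distinct labelled points of `Λ_n` has
  `m ≤ (4n+5)³ =: K`, so the terms `m > K` of `M` do not charge hard-core events
  (`pi_isHardCore_windowRestrict_ofFn_eq_zero`), while for `m ≤ K`, `ξᵐ ≤ max(1, (ξ/z)^K) zᵐ`.

Hence `P(A) = P(A ∩ hc) ≤ M(A ∩ hc) ≤ max(1, (ξ/z)^K) · W γ(A) ≤ max(1, (ξ/z)^K) e^{z vol Λ} γ(A)`
(`windowLaw_canonicalBlowUp_le_smul_gibbsSpecMeasure`), and `C = log(max(1, (ξ/z)^K) e^{z vol Λ_n})`.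

References: H.-O. Georgii, J. Stat. Phys. 80 (1995) §3 (local convergence of averaged canonical ensembles; entropy
bounds relative to the free process); D. Ruelle, *Statistical Mechanics: Rigorous Results* (1969) §4.2.
-/

noncomputable section

open MeasureTheory ProbabilityTheory Set Filter Topology InformationTheory
open scoped ENNReal NNReal

namespace Summit.AtomisticToContinuum.HydrodynamicLimit.Theorems.KiferCompactification

open Literature.MathematicalPhysics.KineticTheory (T3 V3 hsDiameter localGibbsLaw blowUpPoint blowUp
  isProbabilityMeasure_localGibbsLaw v₁ v₁_mul_cube_le gaussMeasure card_le_of_separated)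
open Literature.MathematicalPhysics.KineticTheory.HardSphereDLR (gibbsSpecMeasure gibbsWeightMeasure
  maxwellPhaseMeasure_eq_prod withDensity_maxwellianBeta_eq_map_stdGaussian mem_superposeIn_iff
  measurable_superposeIn_left ae_pi_maxwellPhaseMeasure_good gibbsWeight_univ_ne_zero)
open Literature.MathematicalPhysics.KineticTheory.PointProcess (windowLaw windowRestrict centredBox
  measurable_windowRestrict isProbabilityMeasure_windowLaw)
open Literature.Analysis.FluidPDE (HardSphereFlow Config IsHardCore IsHardSphereGibbs IsTranslationInvariant HardCoreIn
  superposeIn gibbsWeight maxwellPhaseMeasure)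
open Literature.Analysis.FunctionSpaces (PointConfig)

/-! ## The free reference: one-particle law and configuration map -/

/-- **The a-priori law at inverse temperature `θ⁻¹` is `Leb_Λ ⊗ N(u₀, θ)`**: the Maxwellian velocity factor
`M_{θ⁻¹}(v - u₀) dv` is the law of `u₀ + √θ ξ`, `ξ ∼ N(0, I)`, i.e. `gaussMeasure u₀ θ` (`θ > 0`). (Private copy of
`maxwellPhaseMeasure_inv_eq_prod_gaussMeasure` of `…KiferWallGibbsSanity.lean`, whose import closure redeclares
`gibbsSpecMeasure` in this namespace and is therefore not imported here.) -/
private theorem maxwellPhaseMeasure_inv_eq_prod_gaussMeasure' {θ : ℝ} (hθ : 0 < θ) (u₀ : V3) (Λ : Set V3) :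
    maxwellPhaseMeasure θ⁻¹ u₀ Λ = ((volume : Measure V3).restrict Λ).prod (gaussMeasure u₀ θ) := by
  rw [maxwellPhaseMeasure_eq_prod, withDensity_maxwellianBeta_eq_map_stdGaussian (inv_pos.2 hθ) u₀, inv_inv]
  rfl

/-- Nothing belongs to the empty configuration. -/
private theorem notMem_emptyConfig' (p : V3 × V3) : p ∉ (∅ : PointConfig (V3 × V3)) := fun hp =>
  absurd (show p ∈ (∅ : PointConfig (V3 × V3)).carrier from hp) (by simp)

/-- **The superposition with the empty boundary condition is the window configuration of the thrown points**:
`superposeIn Λ x ∅ = {x₁, …, x_k} ∩ (Λ × ℝ³)`. -/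
theorem superposeIn_empty_eq_windowRestrict_ofFn (Λ : Set V3) {k : ℕ} (x : Fin k → V3 × V3) :
    superposeIn Λ x ∅ = windowRestrict Λ (PointConfig.ofFn x) := by
  ext p
  rw [mem_superposeIn_iff]
  change _ ↔ p ∈ PointConfig.ofFn x ∧ p.1 ∈ Λ
  rw [PointConfig.mem_ofFn]
  constructor
  · rintro (⟨hp, hpΛ⟩ | ⟨hp, -⟩)
    · exact ⟨hp, hpΛ⟩
    · exact absurd hp (notMem_emptyConfig' p)
  · rintro ⟨hp, hpΛ⟩
    exact Or.inl ⟨hp, hpΛ⟩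

/-- A hard-core configuration satisfies the window hard-core constraint of every window. -/
theorem hardCoreIn_of_isHardCore {ε : ℝ} {X : PointConfig (V3 × V3)} (h : IsHardCore ε X) (Λ : Set V3) :
    HardCoreIn ε Λ X := fun p hp q hq hpq _ => h p hp q hq hpq

/-! ## Packing: hard-core window configurations of labelled points have boundedly many labels -/

/-- **Packing of labelled hard-core configurations in a centred box.** If the `m` labelled points `x` are pairwise
distinct, all have position in `Λ_n = [-(n+1), n+1)³`, and their window configuration is unit-hard-core, then
`m ≤ (4n+5)³` (positions of norm `≤ 2(n+1)`, pairwise `≥ 1` apart; `card_le_of_separated`). -/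
theorem card_le_of_isHardCore_windowRestrict_ofFn {n m : ℕ} {x : Fin m → V3 × V3}
    (hx : ∀ i, (x i).1 ∈ centredBox (d := Fin 3) n) (hinj : Function.Injective x)
    (h : IsHardCore 1 (windowRestrict (centredBox n) (PointConfig.ofFn x))) : (m : ℝ) ≤ (4 * (n : ℝ) + 5) ^ 3 := by
  have hmem : ∀ j, x j ∈ windowRestrict (centredBox n) (PointConfig.ofFn x) := fun j =>
    ⟨PointConfig.mem_ofFn.2 ⟨j, rfl⟩, hx j⟩
  have hsep : ∀ j ∈ (Finset.univ : Finset (Fin m)), ∀ j' ∈ (Finset.univ : Finset (Fin m)), j ≠ j' →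
      (1 : ℝ) ≤ ‖(x j).1 - (x j').1‖ := fun j _ j' _ hjj' =>
    h (x j) (hmem j) (x j') (hmem j') (hinj.ne hjj')
  have hcard := card_le_of_separated (Finset.univ : Finset (Fin m)) (fun j => (x j).1) one_pos
    (by positivity : (0 : ℝ) ≤ 2 * ((n : ℝ) + 1)) (fun j _ => norm_le_of_mem_centredBox (hx j)) hsep
  rw [Finset.card_univ, Fintype.card_fin] at hcard
  calc (m : ℝ) ≤ (2 * (2 * ((n : ℝ) + 1)) / 1 + 1) ^ 3 := hcard
    _ = (4 * (n : ℝ) + 5) ^ 3 := by ring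

/-- **Beyond the packing number the labelled reference law does not charge hard-core window events**: for
`m > (4n+5)³`, the event "the window configuration on `Λ_n` of the `m` thrown points is unit-hard-core" is null for
the `m`-fold a-priori law `(Leb_{Λ_n} ⊗ Maxwellian)^{⊗m}` (a.s. the thrown points are distinct with positions in
`Λ_n`, `ae_pi_maxwellPhaseMeasure_good`, and then packing applies). -/
theorem pi_isHardCore_windowRestrict_ofFn_eq_zero (β : ℝ) (u₀ : V3) (n : ℕ) {m : ℕ} (hm : (4 * n + 5) ^ 3 < m) :
    (Measure.pi fun _ : Fin m => maxwellPhaseMeasure β u₀ (centredBox (d := Fin 3) n))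
      {x | IsHardCore 1 (windowRestrict (centredBox n) (PointConfig.ofFn x))} = 0 := by
  refine measure_mono_null (fun x hx => ?_)
    (ae_iff.1 (ae_pi_maxwellPhaseMeasure_good β u₀ (measurableSet_centredBox_fin3 n) m))
  simp only [Set.mem_setOf_eq] at hx ⊢
  rintro ⟨hΛ, hinj⟩
  have hle := card_le_of_isHardCore_windowRestrict_ofFn hΛ hinj hx
  have hlt : (((4 * n + 5) ^ 3 : ℕ) : ℝ) < m := by exact_mod_cast hm
  push_cast at hlt
  linarith

/-- **Comparison of the mixture coefficients below the packing number**: for `m ≤ K`,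
`ξᵐ/m! ≤ max(1, (ξ/z)^K) · zᵐ/m!` (`ξ ≥ 0`, `z > 0`). -/
theorem pow_div_factorial_le_max_mul {ξ z : ℝ} (hξ : 0 ≤ ξ) (hz : 0 < z) {K m : ℕ} (hm : m ≤ K) :
    ξ ^ m / m.factorial ≤ max 1 ((ξ / z) ^ K) * (z ^ m / m.factorial) := by
  have hq : 0 ≤ ξ / z := div_nonneg hξ hz.le
  have hpow : (ξ / z) ^ m ≤ max 1 ((ξ / z) ^ K) := by
    rcases le_total (ξ / z) 1 with h1 | h1
    · exact (pow_le_one₀ hq h1).trans (le_max_left _ _)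
    · exact (pow_le_pow_right₀ h1 hm).trans (le_max_right _ _)
  have hξm : ξ ^ m = (ξ / z) ^ m * z ^ m := by
    rw [div_pow, div_mul_cancel₀ _ (pow_ne_zero _ hz.ne')]
  rw [hξm, mul_div_assoc]
  exact mul_le_mul_of_nonneg_right hpow (by positivity)

/-! ## The explicit majorant of the window laws -/

/-- **Explicit uniform window domination.** For `0 < σ ≤ 1/2`, `a, θ > 0`, every centred box `Λ_n`, every size
`N` and flow `Φ`: `(canonicalBlowUpLaw σ a θ u₀ N Φ)_{Λ_n} ≤ ∑ₘ (ξᵐ/m!) · cfg_* (Leb_{Λ_n} ⊗ N(u₀,θ))^{⊗m}`,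
`ξ = σ³/(1 - v₁σ³)` — the majorant exhibited (existentially) by `stub_canonicalBlowUpWindowDomination`, with the same
proof: Fubini over the base point, the union bound over label sets (`measure_windowRestrict_blowUp_le_sum`), Ruelle's
bound with the blow-up change of variables for each label set (`localGibbsLaw_blowUpLabels_le`), and
`C(N+1, m) ((1 - v₁σ³)⁻¹ ε_N³)ᵐ ≤ ξᵐ/m!` (`choose_mul_labelCost_le`). -/
theorem windowLaw_canonicalBlowUp_le_sum {σ a θ : ℝ} (u₀ : V3) (hσ : 0 < σ) (hσ2 : σ ≤ 1 / 2) (ha : 0 < a)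
    (hθ : 0 < θ) (n N : ℕ)
    (Φ : HardSphereFlow (Literature.Analysis.FluidPDE.Torus.geometry (Fin 3)) (hsDiameter σ N) (N + 1)) :
    windowLaw (centredBox n) (canonicalBlowUpLaw σ a θ u₀ N Φ) ≤
      Measure.sum (fun m : ℕ => ENNReal.ofReal (((1 - v₁ * σ ^ 3)⁻¹ * σ ^ 3) ^ m / m.factorial) •
        (Measure.pi (fun _ : Fin m => ((volume : Measure V3).restrict (centredBox n)).prod (gaussMeasure u₀ θ))).map
          (fun w : Fin m → V3 × V3 => windowRestrict (centredBox n) (PointConfig.ofFn w))) := by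
  classical
  set Λ : Set V3 := centredBox n with hΛdef
  have hΛ : MeasurableSet Λ := measurableSet_centredBox_fin3 n
  set c : ℝ := (1 - v₁ * σ ^ 3)⁻¹ with hcdef
  set ξ : ℝ := c * σ ^ 3 with hξdef
  set ρ : Measure (V3 × V3) := ((volume : Measure V3).restrict Λ).prod (gaussMeasure u₀ θ) with hρ
  set cfg : (m : ℕ) → (Fin m → V3 × V3) → PointConfig (V3 × V3) := fun m w => windowRestrict Λ (PointConfig.ofFn w)
    with hcfg
  haveI : IsProbabilityMeasure (volume : Measure T3) := by rw [volume_pi]; infer_instance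
  haveI := isProbabilityMeasure_localGibbsLaw (a₀ := fun _ => a) (θ₀ := fun _ => θ) (u₀ := fun _ => u₀)
    continuous_const continuous_const continuous_const (fun _ => ha) (fun _ => hθ) hσ2 N Φ
  set LG := localGibbsLaw σ (fun _ => a) (fun _ => u₀) (fun _ => θ) N Φ with hLG
  refine Measure.le_iff.2 fun A hA => ?_
  rw [dominatingMeasure_apply hΛ u₀ θ ξ hA]
  -- the window law as a base-point average
  have hpre : MeasurableSet {p : T3 × Config (N + 1) (Fin 3) T3 |
      windowRestrict Λ (blowUp (hsDiameter σ N) p.1 p.2) ∈ A} :=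
    ((measurable_windowRestrict hΛ).comp (measurable_blowUp (hsDiameter σ N) (N + 1))) hA
  have hwl : windowLaw Λ (canonicalBlowUpLaw σ a θ u₀ N Φ) A =
      ∫⁻ x : T3, LG {z | windowRestrict Λ (blowUp (hsDiameter σ N) x z) ∈ A} ∂volume := by
    rw [Literature.MathematicalPhysics.KineticTheory.PointProcess.windowLaw,
      Measure.map_apply (measurable_windowRestrict hΛ) hA, canonicalBlowUpLaw,
      Measure.map_apply (measurable_blowUp _ _) (measurable_windowRestrict hΛ hA)]
    exact Measure.prod_apply hpre
  -- the bound for a fixed base point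
  have hx : ∀ x : T3, LG {z | windowRestrict Λ (blowUp (hsDiameter σ N) x z) ∈ A} ≤
      ∑' m : ℕ, ENNReal.ofReal (ξ ^ m / m.factorial) * Measure.pi (fun _ : Fin m => ρ) (cfg m ⁻¹' A) := by
    intro x
    refine (measure_windowRestrict_blowUp_le_sum LG (hsDiameter σ N) x Λ A).trans ?_
    have hterm : ∀ S : Finset (Fin (N + 1)),
        LG {z | (fun j : Fin S.card => blowUpPoint (hsDiameter σ N) x (z (S.orderEmbOfFin rfl j))) ∈
          {w : Fin S.card → V3 × V3 | (∀ j, (w j).1 ∈ Λ) ∧ windowRestrict Λ (PointConfig.ofFn w) ∈ A}} ≤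
          ENNReal.ofReal ((c * hsDiameter σ N ^ 3) ^ S.card) *
            Measure.pi (fun _ : Fin S.card => ρ) (cfg S.card ⁻¹' A) := by
      intro S
      have hF := measurableSet_windowEvent hΛ S.card hA
      refine (localGibbsLaw_blowUpLabels_le hσ hσ2 ha hθ u₀ x N Φ (S.orderEmbOfFin rfl).injective hF).trans ?_
      rw [measure_pi_windowEvent_eq hΛ u₀ θ S.card hA]
    calc ∑ S : Finset (Fin (N + 1)),
          LG {z | (fun j : Fin S.card => blowUpPoint (hsDiameter σ N) x (z (S.orderEmbOfFin rfl j))) ∈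
            {w : Fin S.card → V3 × V3 | (∀ j, (w j).1 ∈ Λ) ∧ windowRestrict Λ (PointConfig.ofFn w) ∈ A}}
        ≤ ∑ S : Finset (Fin (N + 1)), ENNReal.ofReal ((c * hsDiameter σ N ^ 3) ^ S.card) *
            Measure.pi (fun _ : Fin S.card => ρ) (cfg S.card ⁻¹' A) := Finset.sum_le_sum fun S _ => hterm S
      _ = ∑ m ∈ Finset.range (N + 1 + 1), ((N + 1).choose m : ℝ≥0∞) *
            (ENNReal.ofReal ((c * hsDiameter σ N ^ 3) ^ m) * Measure.pi (fun _ : Fin m => ρ) (cfg m ⁻¹' A)) := by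
          rw [← Finset.powerset_univ, Finset.sum_powerset_apply_card
            (fun m => ENNReal.ofReal ((c * hsDiameter σ N ^ 3) ^ m) * Measure.pi (fun _ : Fin m => ρ) (cfg m ⁻¹' A)),
            Finset.card_univ, Fintype.card_fin]
          simp_rw [nsmul_eq_mul]
      _ ≤ ∑ m ∈ Finset.range (N + 1 + 1), ENNReal.ofReal (ξ ^ m / m.factorial) *
            Measure.pi (fun _ : Fin m => ρ) (cfg m ⁻¹' A) := by
          refine Finset.sum_le_sum fun m _ => ?_
          rw [← mul_assoc]
          refine mul_le_mul' ?_ le_rfl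
          rw [← ENNReal.ofReal_natCast, ← ENNReal.ofReal_mul (Nat.cast_nonneg _)]
          exact ENNReal.ofReal_le_ofReal (choose_mul_labelCost_le hσ hσ2 N m)
      _ ≤ ∑' m : ℕ, ENNReal.ofReal (ξ ^ m / m.factorial) * Measure.pi (fun _ : Fin m => ρ) (cfg m ⁻¹' A) :=
          ENNReal.sum_le_tsum _
  rw [hwl]
  calc ∫⁻ x : T3, LG {z | windowRestrict Λ (blowUp (hsDiameter σ N) x z) ∈ A} ∂volume
      ≤ ∫⁻ _ : T3, ∑' m : ℕ, ENNReal.ofReal (ξ ^ m / m.factorial) * Measure.pi (fun _ : Fin m => ρ) (cfg m ⁻¹' A)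
          ∂volume := lintegral_mono hx
    _ = _ := by rw [lintegral_const, measure_univ, mul_one]

/-! ## The window law is dominated by a multiple of the free law -/

/-- **Setwise domination of the window law by the free block reference.** For `0 < σ ≤ 1/2`, `a, θ, z > 0`, a centred
box `Λ_n`, every size `N` and flow `Φ`:
`(canonicalBlowUpLaw σ a θ u₀ N Φ)_{Λ_n} ≤ max(1, (ξ/z)^{(4n+5)³}) · e^{z vol Λ_n} · γ_{Λ_n}(· | ∅)`, `ξ = σ³/(1 - v₁σ³)`.
The window law is carried by hard-core configurations; on hard-core events the explicit majorant
(`windowLaw_canonicalBlowUp_le_sum`) and the un-normalised free weight `gibbsWeightMeasure … Λ ∅ = W • γ` are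
term-by-term comparable mixtures over the number `m` of thrown points (`ξᵐ ≤ max(1, (ξ/z)^K) zᵐ` for `m ≤ K`, no
contribution for `m > K` by packing), and `W ≤ e^{z vol Λ}`. -/
theorem windowLaw_canonicalBlowUp_le_smul_gibbsSpecMeasure {σ a θ : ℝ} (u₀ : V3) (hσ : 0 < σ) (hσ2 : σ ≤ 1 / 2)
    (ha : 0 < a) (hθ : 0 < θ) {z : ℝ} (hz : 0 < z) (n N : ℕ)
    (Φ : HardSphereFlow (Literature.Analysis.FluidPDE.Torus.geometry (Fin 3)) (hsDiameter σ N) (N + 1)) :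
    windowLaw (centredBox n) (canonicalBlowUpLaw σ a θ u₀ N Φ) ≤
      ENNReal.ofReal (max 1 ((((1 - v₁ * σ ^ 3)⁻¹ * σ ^ 3) / z) ^ ((4 * n + 5) ^ 3)) *
          Real.exp (z * ((volume : Measure V3) (centredBox n)).toReal)) •
        gibbsSpecMeasure 1 z θ⁻¹ u₀ (centredBox n) ∅ := by
  classical
  have hPM := windowLaw_canonicalBlowUp_le_sum u₀ hσ hσ2 ha hθ n N Φ
  have hae0 : ∀ᵐ ω ∂(canonicalBlowUpLaw σ a θ u₀ N Φ), IsHardCore 1 ω := ae_isHardCore_canonicalBlowUp hσ a θ u₀ N Φ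
  set Λ : Set V3 := centredBox n with hΛdef
  have hΛ : MeasurableSet Λ := measurableSet_centredBox_fin3 n
  have hΛv : volume Λ ≠ ∞ := (isBounded_centredBox n).measure_lt_top.ne
  set ξ : ℝ := (1 - v₁ * σ ^ 3)⁻¹ * σ ^ 3 with hξdef
  set K : ℕ := (4 * n + 5) ^ 3 with hKdef
  set L : ℝ := max 1 ((ξ / z) ^ K) with hLdef
  set V : ℝ := (volume Λ).toReal with hVdef
  have hξ0 : 0 ≤ ξ := by
    have := v₁_mul_cube_le hσ.le hσ2
    exact mul_nonneg (inv_nonneg.2 (by linarith)) (pow_nonneg hσ.le 3)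
  have hL0 : 0 ≤ L := zero_le_one.trans (le_max_left _ _)
  set ρ : Measure (V3 × V3) := maxwellPhaseMeasure θ⁻¹ u₀ Λ with hρdef
  have hρ : ((volume : Measure V3).restrict Λ).prod (gaussMeasure u₀ θ) = ρ :=
    (maxwellPhaseMeasure_inv_eq_prod_gaussMeasure' hθ u₀ Λ).symm
  set P : Measure (PointConfig (V3 × V3)) := windowLaw Λ (canonicalBlowUpLaw σ a θ u₀ N Φ) with hPdef
  set H : Set (PointConfig (V3 × V3)) := {X | IsHardCore 1 X} with hHdef
  have hHm : MeasurableSet H := measurableSet_setOf_isHardCore 1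
  -- the window law is carried by hard-core configurations
  have hae : ∀ᵐ ω ∂P, IsHardCore 1 ω := by
    rw [hPdef, Literature.MathematicalPhysics.KineticTheory.PointProcess.windowLaw,
      ae_map_iff (measurable_windowRestrict hΛ).aemeasurable hHm]
    filter_upwards [hae0] with ω hω using isHardCore_windowRestrict hω Λ
  have hPH : P Hᶜ = 0 := by
    have h := ae_iff.1 hae
    rwa [← Set.compl_setOf] at h
  -- the normalising free weight
  set W : ℝ≥0∞ := gibbsWeight 1 z θ⁻¹ u₀ Λ ∅ univ with hWdef
  have hW0 : W ≠ 0 := gibbsWeight_univ_ne_zero 1 z θ⁻¹ u₀ Λ ∅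
  have hWle : W ≤ ENNReal.ofReal (Real.exp (z * V)) :=
    gibbsWeight_univ_le_ofReal_exp 1 hz.le (inv_pos.2 hθ) u₀ hΛ hΛv ∅
  have hWtop : W ≠ ∞ := (hWle.trans_lt ENNReal.ofReal_lt_top).ne
  refine Measure.le_iff.2 fun A hA => ?_
  rw [Measure.smul_apply, smul_eq_mul]
  -- the majorant on the hard-core part of the event
  have h2 : P (A ∩ H) ≤ ∑' m : ℕ, ENNReal.ofReal (ξ ^ m / m.factorial) *
      (Measure.pi fun _ : Fin m => ρ)
        ((fun w : Fin m → V3 × V3 => windowRestrict Λ (PointConfig.ofFn w)) ⁻¹' (A ∩ H)) := by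
    have h := Measure.le_iff.1 hPM (A ∩ H) (hA.inter hHm)
    rw [dominatingMeasure_apply hΛ u₀ θ ξ (hA.inter hHm), hρ] at h
    exact h
  -- the un-normalised free weight of the event
  have h3 : gibbsWeightMeasure 1 z θ⁻¹ u₀ Λ ∅ A = ∑' m : ℕ, ENNReal.ofReal (z ^ m / m.factorial) *
      (Measure.pi fun _ : Fin m => ρ) ((fun x : Fin m → V3 × V3 => superposeIn Λ x ∅) ⁻¹' A ∩
        {x | HardCoreIn 1 Λ (superposeIn Λ x ∅)}) := by
    rw [gibbsWeightMeasure, Measure.sum_apply _ hA]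
    refine tsum_congr fun m => ?_
    rw [Measure.smul_apply, smul_eq_mul, Measure.map_apply (measurable_superposeIn_left hΛ m ∅) hA,
      Measure.restrict_apply (hA.preimage (measurable_superposeIn_left hΛ m ∅))]
  have hGW : gibbsWeightMeasure 1 z θ⁻¹ u₀ Λ ∅ A = W * gibbsSpecMeasure 1 z θ⁻¹ u₀ Λ ∅ A := by
    rw [gibbsSpecMeasure, Measure.smul_apply, smul_eq_mul, ← mul_assoc, ENNReal.mul_inv_cancel hW0 hWtop, one_mul]
  -- term-by-term comparison
  have h4 : ∀ m : ℕ, ENNReal.ofReal (ξ ^ m / m.factorial) *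
      (Measure.pi fun _ : Fin m => ρ)
        ((fun w : Fin m → V3 × V3 => windowRestrict Λ (PointConfig.ofFn w)) ⁻¹' (A ∩ H)) ≤
      ENNReal.ofReal L * (ENNReal.ofReal (z ^ m / m.factorial) *
        (Measure.pi fun _ : Fin m => ρ) ((fun x : Fin m → V3 × V3 => superposeIn Λ x ∅) ⁻¹' A ∩
          {x | HardCoreIn 1 Λ (superposeIn Λ x ∅)})) := by
    intro m
    have hsub : (fun w : Fin m → V3 × V3 => windowRestrict Λ (PointConfig.ofFn w)) ⁻¹' (A ∩ H) ⊆
        (fun x : Fin m → V3 × V3 => superposeIn Λ x ∅) ⁻¹' A ∩ {x | HardCoreIn 1 Λ (superposeIn Λ x ∅)} := by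
      intro w hw
      simp only [Set.mem_preimage, Set.mem_inter_iff, Set.mem_setOf_eq, hHdef] at hw ⊢
      rw [superposeIn_empty_eq_windowRestrict_ofFn]
      exact ⟨hw.1, hardCoreIn_of_isHardCore hw.2 Λ⟩
    by_cases hm : m ≤ K
    · rw [← mul_assoc, ← ENNReal.ofReal_mul hL0]
      exact mul_le_mul' (ENNReal.ofReal_le_ofReal (pow_div_factorial_le_max_mul hξ0 hz hm)) (measure_mono hsub)
    · have h0 : (Measure.pi fun _ : Fin m => ρ)
          ((fun w : Fin m → V3 × V3 => windowRestrict Λ (PointConfig.ofFn w)) ⁻¹' (A ∩ H)) = 0 :=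
        measure_mono_null (fun w hw => hw.2) (pi_isHardCore_windowRestrict_ofFn_eq_zero θ⁻¹ u₀ n (not_le.1 hm))
      rw [h0, mul_zero]
      exact zero_le
  -- assembly
  calc P A = P (A ∩ H) := (measure_inter_conull hPH).symm
    _ ≤ _ := h2
    _ ≤ ∑' m : ℕ, ENNReal.ofReal L * (ENNReal.ofReal (z ^ m / m.factorial) *
        (Measure.pi fun _ : Fin m => ρ) ((fun x : Fin m → V3 × V3 => superposeIn Λ x ∅) ⁻¹' A ∩
          {x | HardCoreIn 1 Λ (superposeIn Λ x ∅)})) := ENNReal.tsum_le_tsum h4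
    _ = ENNReal.ofReal L * (W * gibbsSpecMeasure 1 z θ⁻¹ u₀ Λ ∅ A) := by rw [ENNReal.tsum_mul_left, ← h3, hGW]
    _ ≤ ENNReal.ofReal L * (ENNReal.ofReal (Real.exp (z * V)) * gibbsSpecMeasure 1 z θ⁻¹ u₀ Λ ∅ A) :=
        mul_le_mul' le_rfl (mul_le_mul' hWle le_rfl)
    _ = ENNReal.ofReal (L * Real.exp (z * V)) * gibbsSpecMeasure 1 z θ⁻¹ u₀ Λ ∅ A := by
        rw [← mul_assoc, ← ENNReal.ofReal_mul hL0]

/-! ## The registered stub -/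

/-- Registered stub `c9_klDiv_windowLaw_canonicalBlowUp_free_le` (line `FirstLemma`): **uniform-in-`N` finiteness of
the window entropy of the blown-up canonical law against the free block reference.** For `0 < σ ≤ 1/2`,
`a, θ, z > 0` and every centred box `Λ_n` there is `C` (namely `C = log(max(1, (ξ/z)^{(4n+5)³}) e^{z vol Λ_n})`,
`ξ = σ³/(1 - v₁σ³)`) with `KL((canonicalBlowUpLaw σ a θ u₀ N Φ)_{Λ_n} ‖ γ_{Λ_n}(· | ∅)) ≤ C` for all `N`, `Φ`: the
window law `P` satisfies `P ≤ e^C • γ` (`windowLaw_canonicalBlowUp_le_smul_gibbsSpecMeasure`), hence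
`KL(P ‖ γ) ≤ KL(P ‖ P) + C = C` (`klDiv_le_klDiv_add_ofReal_log_of_le_smul`, `klDiv_self`). -/
theorem c9_klDiv_windowLaw_canonicalBlowUp_free_le (σ a θ : ℝ) (u₀ : V3) (hσ : 0 < σ) (hσ2 : σ ≤ 1 / 2)
    (ha : 0 < a) (hθ : 0 < θ) {z : ℝ} (hz : 0 < z) (n : ℕ) :
    ∃ C : ℝ, ∀ (N : ℕ) (Φ : HardSphereFlow (Literature.Analysis.FluidPDE.Torus.geometry (Fin 3)) (hsDiameter σ N) (N + 1)),
      klDiv (windowLaw (centredBox n) (canonicalBlowUpLaw σ a θ u₀ N Φ))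
          (gibbsSpecMeasure 1 z θ⁻¹ u₀ (centredBox n) ∅) ≤ ENNReal.ofReal C := by
  refine ⟨Real.log (max 1 ((((1 - v₁ * σ ^ 3)⁻¹ * σ ^ 3) / z) ^ ((4 * n + 5) ^ 3)) *
      Real.exp (z * ((volume : Measure V3) (centredBox n)).toReal)), fun N Φ => ?_⟩
  have hΛ : MeasurableSet (centredBox (d := Fin 3) n) := measurableSet_centredBox_fin3 n
  haveI : IsProbabilityMeasure (canonicalBlowUpLaw σ a θ u₀ N Φ) :=
    isProbabilityMeasure_canonicalBlowUp u₀ hσ2 ha hθ N Φ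
  haveI : IsProbabilityMeasure (windowLaw (centredBox n) (canonicalBlowUpLaw σ a θ u₀ N Φ)) :=
    isProbabilityMeasure_windowLaw hΛ _
  haveI : IsProbabilityMeasure (gibbsSpecMeasure 1 z θ⁻¹ u₀ (centredBox (d := Fin 3) n) ∅) :=
    isProbabilityMeasure_gibbsSpecMeasure_empty hz.le (inv_pos.2 hθ) u₀ hΛ (isBounded_centredBox n).measure_lt_top.ne
  have h := klDiv_le_klDiv_add_ofReal_log_of_le_smul (windowLaw (centredBox n) (canonicalBlowUpLaw σ a θ u₀ N Φ))
    (windowLaw (centredBox n) (canonicalBlowUpLaw σ a θ u₀ N Φ)) (gibbsSpecMeasure 1 z θ⁻¹ u₀ (centredBox n) ∅)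
    (windowLaw_canonicalBlowUp_le_smul_gibbsSpecMeasure u₀ hσ hσ2 ha hθ hz n N Φ)
  rwa [klDiv_self, zero_add] at h

end Summit.AtomisticToContinuum.HydrodynamicLimit.Theorems.KiferCompactification

end
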